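import Mathlib
import Literature.Analysis.Calculus.ClosedSubgroupTubularChart
import HarnessLib

/-!
# The tube `H · (1 + 𝔨_r)` of a closed linear group: openness and the analytic projections

Continuation of `ClosedSubgroupTubularChart.lean` (same setting: `𝔸` a finite-dimensional real
Banach algebra, `H ⊆ 𝔸` a subgroup of units closed in `𝔸`, `𝔥` its Lie algebra, `𝔨` a linear
complement). Everything here is PROVED; no definitions, no named facts.

`exists_tubularMaps`: for the uniqueness radius `r` of the tubular chart, the tube
`T = {h(1 + A) : h ∈ H, A ∈ 𝔨, ‖A‖ < r}` is OPEN in `𝔸`, and the two projections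
`q(h(1 + A)) = h` ("group part") and `a(h(1 + A)) = A` ("normal part") are well defined,
real-ANALYTIC on `T`, and equivariant under left multiplication by `H`
(`q(hM) = h q(M)`, `a(hM) = a(M)`). Locally at `M₀ = h₀(1 + A₀)` both are read off the analytic
inverse of the chart: `(X, A) = Ψ⁻¹(h₀⁻¹ M)`, `q(M) = h₀ exp X`, `a(M) = A`.

This is the form in which the embedded-submanifold structure of a closed linear group (Hall,
Thm. 3.42, Cor. 3.45) is consumed by measure theory: `T` is an `H`-invariant open set fibred over
`H` by `q`, with fibres the translates of the ball `1 + 𝔨_r`, so that the push-forward of Lebesgue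
measure on `T` under `q` is a left-invariant — hence Haar — measure on a compact `H`
(`MathematicalPhysics/QuantumFieldTheory/WilsonPartitionRegularVariationProofs.lean`).

## References

* B. C. Hall, *Lie Groups, Lie Algebras, and Representations*, GTM 222, 2nd ed. (2015), Thm. 3.42,
  Cor. 3.45. [Hall2015]
-/

noncomputable section

open NormedSpace Filter Topology Set Metric

namespace Literature.Analysis.Calculus

variable {𝔸 : Type*} [NormedRing 𝔸] [NormedAlgebra ℚ 𝔸] [NormedAlgebra ℝ 𝔸] [CompleteSpace 𝔸]
  [FiniteDimensional ℝ 𝔸] {H : Set 𝔸}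

omit [NormedAlgebra ℚ 𝔸] [NormedAlgebra ℝ 𝔸] [CompleteSpace 𝔸] [FiniteDimensional ℝ 𝔸] in
/-- Left translation by an element of `H` with two-sided inverse `c` maps a set `S` onto the
preimage of `S` under left translation by `c`. [folklore] -/
theorem image_mul_left_eq_preimage {h c : 𝔸} (hch : c * h = 1) (hhc : h * c = 1) (S : Set 𝔸) :
    (fun M => h * M) '' S = (fun M => c * M) ⁻¹' S := by
  ext M
  simp only [mem_image, mem_preimage]
  constructor
  · rintro ⟨M', hM', rfl⟩
    rwa [← mul_assoc, hch, one_mul]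
  · intro hM
    exact ⟨c * M, hM, by rw [← mul_assoc, hhc, one_mul]⟩

/-- **The tube of a closed linear group and its analytic projections.** With `r` the uniqueness
radius of `exists_tubularChart`: the tube `T = {h(1 + A) : h ∈ H, A ∈ 𝔨, ‖A‖ < r}` is open, and
there are maps `q a : 𝔸 → 𝔸`, real-analytic on `T`, with `q(h(1 + A)) = h`, `a(h(1 + A)) = A`
(`h ∈ H`, `A ∈ 𝔨`, `‖A‖ < r`), `M = q(M)(1 + a(M))`, `q(M) ∈ H`, `a(M) ∈ 𝔨`, `‖a(M)‖ < r` on `T`,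
and `q(hM) = h q(M)`, `a(hM) = a(M)` for `h ∈ H`, `M ∈ T` (Hall, Cor. 3.45: `H` is an embedded
analytic submanifold of `𝔸ˣ`; tubular form). [cite: Hall2015, Theorem 3.42 and Corollary 3.45] -/
theorem exists_tubularMaps (hH : IsClosed H) (h1 : (1 : 𝔸) ∈ H)
    (hmul : ∀ a ∈ H, ∀ b ∈ H, a * b ∈ H) (hinv : ∀ a ∈ H, ∃ b ∈ H, b * a = 1)
    (𝔥 𝔨 : Submodule ℝ 𝔸) (h𝔥 : ∀ X : 𝔸, X ∈ 𝔥 ↔ ∀ t : ℝ, exp (t • X) ∈ H) (hc : IsCompl 𝔥 𝔨) :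
    ∃ r : ℝ, 0 < r ∧ r ≤ 1 / 2 ∧ ∃ q a : 𝔸 → 𝔸,
      IsOpen {M : 𝔸 | ∃ h ∈ H, ∃ A ∈ 𝔨, ‖A‖ < r ∧ M = h * (1 + A)} ∧
      (∀ h ∈ H, ∀ A ∈ 𝔨, ‖A‖ < r → q (h * (1 + A)) = h ∧ a (h * (1 + A)) = A) ∧
      (∀ M ∈ {M : 𝔸 | ∃ h ∈ H, ∃ A ∈ 𝔨, ‖A‖ < r ∧ M = h * (1 + A)},
        q M ∈ H ∧ a M ∈ 𝔨 ∧ ‖a M‖ < r ∧ M = q M * (1 + a M)) ∧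
      (∀ h ∈ H, ∀ M ∈ {M : 𝔸 | ∃ h ∈ H, ∃ A ∈ 𝔨, ‖A‖ < r ∧ M = h * (1 + A)},
        h * M ∈ {M : 𝔸 | ∃ h ∈ H, ∃ A ∈ 𝔨, ‖A‖ < r ∧ M = h * (1 + A)} ∧
        q (h * M) = h * q M ∧ a (h * M) = a M) ∧
      AnalyticOnNhd ℝ q {M : 𝔸 | ∃ h ∈ H, ∃ A ∈ 𝔨, ‖A‖ < r ∧ M = h * (1 + A)} ∧
      AnalyticOnNhd ℝ a {M : 𝔸 | ∃ h ∈ H, ∃ A ∈ 𝔨, ‖A‖ < r ∧ M = h * (1 + A)} := by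
  classical
  obtain ⟨Φ, δ, r, hΦ, hr, hrδ, hr2, hsrc, hsymm, huniq⟩ :=
    exists_tubularChart hH h1 hmul hinv 𝔥 𝔨 h𝔥 hc
  set T : Set 𝔸 := {M : 𝔸 | ∃ h ∈ H, ∃ A ∈ 𝔨, ‖A‖ < r ∧ M = h * (1 + A)} with hT
  -- the projections, by choice
  let q : 𝔸 → 𝔸 := fun M => if hM : M ∈ T then hM.choose else M
  let a : 𝔸 → 𝔸 := fun M => if hM : M ∈ T then hM.choose_spec.2.choose else 0
  have hqa : ∀ h ∈ H, ∀ A ∈ 𝔨, ‖A‖ < r → q (h * (1 + A)) = h ∧ a (h * (1 + A)) = A := by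
    intro h hh A hA hAr
    have hM : h * (1 + A) ∈ T := ⟨h, hh, A, hA, hAr, rfl⟩
    have hq : q (h * (1 + A)) = hM.choose := dif_pos hM
    have ha : a (h * (1 + A)) = hM.choose_spec.2.choose := dif_pos hM
    obtain ⟨hh', A', hA', hA'r, heq⟩ := hM.choose_spec
    have hspec := hM.choose_spec.2.choose_spec
    have key := huniq h hh _ hM.choose_spec.1 A hA _ hspec.1 hAr hspec.2.1 hspec.2.2
    exact ⟨hq.trans key.1.symm, ha.trans key.2.symm⟩
  have hrep : ∀ M ∈ T, q M ∈ H ∧ a M ∈ 𝔨 ∧ ‖a M‖ < r ∧ M = q M * (1 + a M) := by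
    rintro M ⟨h, hh, A, hA, hAr, rfl⟩
    obtain ⟨hq, ha⟩ := hqa h hh A hA hAr
    rw [hq, ha]
    exact ⟨hh, hA, hAr, rfl⟩
  have hequiv : ∀ h ∈ H, ∀ M ∈ T, h * M ∈ T ∧ q (h * M) = h * q M ∧ a (h * M) = a M := by
    rintro h hh M ⟨h', hh', A, hA, hAr, rfl⟩
    have hmem : h * (h' * (1 + A)) ∈ T := ⟨h * h', hmul h hh h' hh', A, hA, hAr, by rw [mul_assoc]⟩
    obtain ⟨hq, ha⟩ := hqa h' hh' A hA hAr
    obtain ⟨hq2, ha2⟩ := hqa (h * h') (hmul h hh h' hh') A hA hAr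
    refine ⟨hmem, ?_, ?_⟩
    · rw [← mul_assoc, hq2, hq]
    · rw [← mul_assoc, ha2, ha]
  -- `exp X ∈ H` for `X ∈ 𝔥`
  have hexpH : ∀ X : 𝔥, exp (X : 𝔸) ∈ H := fun X => by
    simpa using ((h𝔥 X).1 X.2) 1
  -- openness of the tube
  have hVopen : IsOpen (Φ.source ∩ {p : 𝔥 × 𝔨 | ‖(p.2 : 𝔸)‖ < r}) :=
    Φ.open_source.inter (isOpen_lt (continuous_norm.comp (continuous_subtype_val.comp
      continuous_snd)) continuous_const)
  have hΦV : IsOpen (Φ '' (Φ.source ∩ {p : 𝔥 × 𝔨 | ‖(p.2 : 𝔸)‖ < r})) :=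
    Φ.isOpen_image_of_subset_source hVopen inter_subset_left
  have hTeq : T = ⋃ h ∈ H, (fun M => h * M) '' (Φ '' (Φ.source ∩ {p : 𝔥 × 𝔨 | ‖(p.2 : 𝔸)‖ < r})) := by
    ext M
    simp only [mem_iUnion, mem_image, exists_prop]
    constructor
    · rintro ⟨h, hh, A, hA, hAr, rfl⟩
      refine ⟨h, hh, 1 + A, ⟨(0, ⟨A, hA⟩), ⟨hsrc ?_, by simpa using hAr⟩, ?_⟩, rfl⟩
      · rw [mem_ball_zero_iff, Prod.norm_mk, max_lt_iff]
        exact ⟨by simpa using hr.trans hrδ, by simpa using hAr.trans hrδ⟩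
      · rw [hΦ]; simp
    · rintro ⟨h, hh, M', ⟨p, ⟨-, hp⟩, rfl⟩, rfl⟩
      refine ⟨h * exp (p.1 : 𝔸), hmul h hh _ (hexpH p.1), p.2, p.2.2, hp, ?_⟩
      rw [hΦ]; simp [mul_assoc]
  have hTopen : IsOpen T := by
    rw [hTeq]
    refine isOpen_biUnion fun h hh => ?_
    obtain ⟨c, hcH, hch⟩ := hinv h hh
    rw [image_mul_left_eq_preimage hch (mul_eq_one_comm_of_mem hinv hcH hch)]
    exact hΦV.preimage (continuous_const.mul continuous_id)
  -- local analytic formulas for `q` and `a`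
  have hlocal : ∀ M₀ ∈ T, AnalyticAt ℝ q M₀ ∧ AnalyticAt ℝ a M₀ := by
    rintro M₀ ⟨h₀, hh₀, A₀, hA₀, hA₀r, rfl⟩
    obtain ⟨c₀, hc₀, hc₀h₀⟩ := hinv h₀ hh₀
    have hh₀c₀ : h₀ * c₀ = 1 := mul_eq_one_comm_of_mem hinv hc₀ hc₀h₀
    set p₀ : 𝔥 × 𝔨 := (0, ⟨A₀, hA₀⟩) with hp₀
    have hp₀b : p₀ ∈ ball (0 : 𝔥 × 𝔨) δ := by
      rw [mem_ball_zero_iff, hp₀, Prod.norm_mk, max_lt_iff]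
      exact ⟨by simpa using hr.trans hrδ, by simpa using hA₀r.trans hrδ⟩
    have hp₀s : p₀ ∈ Φ.source := hsrc hp₀b
    have hΦp₀ : Φ p₀ = 1 + A₀ := by rw [hΦ]; simp [hp₀]
    have hcM₀ : c₀ * (h₀ * (1 + A₀)) = Φ p₀ := by rw [hΦp₀, ← mul_assoc, hc₀h₀, one_mul]
    -- the map `G M = Φ.symm (c₀ M)` is analytic at `M₀`
    have hmulan : AnalyticAt ℝ (fun M : 𝔸 => c₀ * M) (h₀ * (1 + A₀)) :=
      (ContinuousLinearMap.mul ℝ 𝔸 c₀).analyticAt _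
    have hG : AnalyticAt ℝ (fun M : 𝔸 => Φ.symm (c₀ * M)) (h₀ * (1 + A₀)) := by
      have hs : AnalyticAt ℝ Φ.symm ((fun M : 𝔸 => c₀ * M) (h₀ * (1 + A₀))) := by
        rw [show (fun M : 𝔸 => c₀ * M) (h₀ * (1 + A₀)) = Φ p₀ from hcM₀]
        exact hsymm p₀ hp₀b
      exact AnalyticAt.comp (f := fun M : 𝔸 => c₀ * M) hs hmulan
    -- the eventual identities
    have hGcont : ContinuousAt (fun M : 𝔸 => Φ.symm (c₀ * M)) (h₀ * (1 + A₀)) := hG.continuousAt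
    have hev1 : ∀ᶠ M in 𝓝 (h₀ * (1 + A₀)), c₀ * M ∈ Φ.target := by
      have : c₀ * (h₀ * (1 + A₀)) ∈ Φ.target := by rw [hcM₀]; exact Φ.map_source hp₀s
      exact hmulan.continuousAt.preimage_mem_nhds (Φ.open_target.mem_nhds this)
    have hev2 : ∀ᶠ M in 𝓝 (h₀ * (1 + A₀)),
        Φ.symm (c₀ * M) ∈ ball (0 : 𝔥 × 𝔨) δ ∩ {p : 𝔥 × 𝔨 | ‖(p.2 : 𝔸)‖ < r} := by
      refine hGcont.preimage_mem_nhds ((isOpen_ball.inter (isOpen_lt (continuous_norm.comp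
        (continuous_subtype_val.comp continuous_snd)) continuous_const)).mem_nhds ?_)
      have : Φ.symm (c₀ * (h₀ * (1 + A₀))) = p₀ := by rw [hcM₀]; exact Φ.left_inv hp₀s
      rw [this]
      exact ⟨hp₀b, by simpa [hp₀] using hA₀r⟩
    have hev : ∀ᶠ M in 𝓝 (h₀ * (1 + A₀)),
        q M = h₀ * exp ((Φ.symm (c₀ * M)).1 : 𝔸) ∧ a M = ((Φ.symm (c₀ * M)).2 : 𝔸) := by
      filter_upwards [hev1, hev2] with M hM1 hM2
      set p := Φ.symm (c₀ * M) with hp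
      have hΦp : Φ p = c₀ * M := Φ.right_inv hM1
      have hM : M = (h₀ * exp (p.1 : 𝔸)) * (1 + (p.2 : 𝔸)) := by
        have : c₀ * M = exp (p.1 : 𝔸) * (1 + (p.2 : 𝔸)) := by rw [← hΦp, hΦ]
        calc M = h₀ * (c₀ * M) := by rw [← mul_assoc, hh₀c₀, one_mul]
          _ = _ := by rw [this, mul_assoc]
      have key := hqa (h₀ * exp (p.1 : 𝔸)) (hmul h₀ hh₀ _ (hexpH p.1)) (p.2 : 𝔸) p.2.2 hM2.2
      rw [← hM] at key
      exact ⟨key.1, key.2⟩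
    -- analyticity of the formulas
    have hsnd : AnalyticAt ℝ (fun M : 𝔸 => ((Φ.symm (c₀ * M)).2 : 𝔸)) (h₀ * (1 + A₀)) :=
      ((𝔨.subtypeL.comp (ContinuousLinearMap.snd ℝ 𝔥 𝔨)).analyticAt _).comp hG
    have hfst : AnalyticAt ℝ (fun M : 𝔸 => ((Φ.symm (c₀ * M)).1 : 𝔸)) (h₀ * (1 + A₀)) :=
      ((𝔥.subtypeL.comp (ContinuousLinearMap.fst ℝ 𝔥 𝔨)).analyticAt _).comp hG
    have hq' : AnalyticAt ℝ (fun M : 𝔸 => h₀ * exp ((Φ.symm (c₀ * M)).1 : 𝔸)) (h₀ * (1 + A₀)) :=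
      analyticAt_const.mul (AnalyticAt.comp (f := fun M : 𝔸 => ((Φ.symm (c₀ * M)).1 : 𝔸))
        (exp_analytic (𝕂 := ℝ) _) hfst)
    refine ⟨hq'.congr ?_, hsnd.congr ?_⟩
    · filter_upwards [hev] with M hM using hM.1.symm
    · filter_upwards [hev] with M hM using hM.2.symm
  exact ⟨r, hr, hr2, q, a, hTopen, hqa, hrep, hequiv, fun M hM => (hlocal M hM).1,
    fun M hM => (hlocal M hM).2⟩

end Literature.Analysis.Calculus

end
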